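import Literature.Computability.Complexity.GateEliminationCase824K
import Literature.Computability.Complexity.GateEliminationCase822

/-!
# Gate elimination: Cases 8.2.3 and 8.2.4 of Li–Yang's proof of Theorem 4.1; Cases 6–8 assembled

Li–Yang, ECCC TR21-023, §4.1, pp. 31–35. With `Q` a `1`-gate (Case 8.2.2, `fanout(Q) ≥ 2`, is
`GateEliminationCase822.lean`):

* **Case 8.2.3** (`case8_2_3`): the other wire of `G` is a variable `t`, an unprotected
  `1`-variable (Cases 1, 3, 7); after `x_k := d` (Case 6, `Δμ ≥ 1 + α_I + α_Q`), Case 8.1.2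
  inside the new circuit (`case8_1_2_raw`: `Δμ ≥ 2α_I + 1 - α_φ`); `Δμ ≥ 3α_I ≥ 2δ` in total.
* **Case 8.2.4** (`case8_2_4`): the other wire is a `1`-gate `Q'` of the xor-part depending on
  protected variables only. If `Q` or `Q'` reads two variables: Case 8.2.1 / 8.2.4.2
  (`stepGoal_of_reads_two_vars`). If a variable of `supp(Q)` (resp. `supp(Q')`) has its couple
  not read by `Q'` (resp. `Q`): **Case 8.2.4.1** (`ProtSubstSit.case8_2_4_good`): after
  `x_k := d`, either the gate read by `G` is a `2⁺`-gate (Case 8.2.2, `case8_2_2_induct`) or the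
  xor-reconstruction step `case8_2_4_K` applies, whose special configurations (the printed
  items 3(a)–(d), Cases 8.2.4.1.1–8.2.4.1.3 and 8.2.5) are dispatched by `stepGoal_of_conf8252a`,
  Case 8.1 / `case8_2_2_induct` at an ∧-type gate reading the path gate before `Q`, and
  `stepGoal_of_confL5` (an ∧-type gate reading two variables, one of out-degree `≥ 3`: Case 3,
  Cases 6.2.2.1–3, or Case 8.1 at `P_k`). Otherwise **Case 8.2.4.3**: a contradiction
  (`not_dependsOn_of_noPath`: "there is no path from `x_k` to `R`, hence `R` does not depend on
  `x_k`", and non-degeneracy).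

`case8_2` is Case 8.2 in the form required by `LiYang2022_cases6to8_of_case8_2`
(`GateEliminationCase8Dispatch.lean`), so the named fact `LiYang2022_cases6to8` is PROVED:
`LiYang2022_cases6to8_holds`. No statement of the chain is changed.

## References

* J. Li, T. Yang, *3.1n − o(n) circuit lower bounds for explicit functions*, STOC 2022
  [LiYang2022]; full version ECCC TR21-023, §4.1 (Cases 6, 8, 8.1.2, 8.2.1–8.2.5), Prop. 2.7.
-/

namespace Literature.Computability.Complexity

open Finset

namespace Semicircuit

variable {n : ℕ} {C : Semicircuit n} {f : (Fin n → ZMod 2) → Bool} {R : RdqSource n} {d : ℕ} {αφ αI αQ : ℝ}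

/-! ### Case 8.1.2 with its raw measure bound -/

/-- **Case 8.1.2 of Li–Yang's proof of Theorem 4.1, raw bound**: as `case8_1_2`, concluding with
the measure decrement `2α_I + (1 - α_φ)` itself (needed when this step is the second of two
substitutions, Case 8.2.3). [cite: LiYang2022, §4.1 (Cases 8.1.2, 8.2.3)] -/
theorem case8_1_2_raw (hf : IsAffineDisperser f d) (hd : 2 * d + 2 ≤ R.dim) (hF : C.Fair)
    (hC : C.ComputesRestr f R) {P : Finset (Fin C.m × Fin C.m)} (hP : C.IsPacking P)
    (hφ : 0 ≤ αφ) (hI : 0 ≤ αI) (αQ : ℝ)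
    {G Q : Fin C.m} {aQ : Fin 2} (hand : IsAndOp (C.op G)) (hGQ : C.arg G aQ = .gate Q)
    {x : Fin n} (p : C.XorPath x Q) (hdep : C.DependsOn hF Q x) (hxp : ¬ R.Protected x)
    {t : Fin n} (hGt : C.arg G aQ.rev = .var t) (ht1 : C.fanout (.var t) = 1) (htp : ¬ R.Protected t)
    (htx : t ≠ x) :
    ∃ (C' : Semicircuit n) (R' : RdqSource n) (P' : Finset (Fin C'.m × Fin C'.m)),
      C'.Fair ∧ C'.ComputesRestr f R' ∧ C'.IsPacking P' ∧ R'.dim + 1 = R.dim ∧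
        C'.measure αφ αI αQ P' R' ≤ C.measure αφ αI αQ P R - 2 * αI - (1 - αφ) := by
  classical
  obtain ⟨b, hb⟩ := exists_trivializing hand aQ
  obtain ⟨P', hF', hC', hP', hdim, -, hprot, hμ'⟩ := C.xor_reconstruction hF hC hP p hdep hxp b hφ hI αQ
  have h₀ : (C.reroute p b).arg G aQ = .const b := reroute_arg_reader p b hand hGQ
  have hGt' : (C.reroute p b).arg G aQ.rev = .var t := by
    rw [reroute_arg_reader_rev p b hand, hGt, Node.reroute_var_of_ne x Q b htx]
  have htriv' : (C.reroute p b).liveFn G aQ b false = (C.reroute p b).liveFn G aQ b true := by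
    rw [liveFn_reroute_reader p b hand]; exact hb
  have hout' : (C.reroute p b).out ≠ .gate G := out_ne_of_trivialized hf (by omega) hF' hC' h₀ htriv'
  let E := elimDataWTriv hF' hC' hP' h₀ htriv' hout' hφ hI αQ
  have hrepl : E.repl = .const ((C.reroute p b).liveFn G aQ b false) := rfl
  have hft' : (C.reroute p b).fanout (.var t) = 1 := by
    rw [fanout_reroute_of_generic p b (v := .var t) (fun e => htx (Node.var.inj e)) (by simp) (by simp)]
    exact ht1
  have hft : E.C'.fanout (.var t) = 0 := by
    have h1 := E.fanout_var_add (i := t) (by rw [hrepl]; exact fun h => by cases h)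
    have h2 : 1 ≤ (univ.filter fun a : Fin 2 => (C.reroute p b).arg G a = .var t).card :=
      card_pos.mpr ⟨aQ.rev, mem_filter.mpr ⟨mem_univ _, hGt'⟩⟩
    omega
  have htinf' : t ∈ (C.reroute p b).influential (C.rerouteSource hF b hC p hxp) := by
    unfold influential; exact mem_filter.mpr ⟨mem_univ _, Or.inl (by omega)⟩
  have htinf : t ∉ E.C'.influential (C.rerouteSource hF b hC p hxp) := by
    unfold influential
    rw [mem_filter, not_and]
    intro _ h
    rcases h with h | h
    · omega
    · exact htp ((hprot t).mp h)
  have hcard : (E.C'.influential (C.rerouteSource hF b hC p hxp)).card + 1 ≤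
      ((C.reroute p b).influential (C.rerouteSource hF b hC p hxp)).card := by
    have hsub : E.C'.influential (C.rerouteSource hF b hC p hxp) ⊆
        ((C.reroute p b).influential (C.rerouteSource hF b hC p hxp)).erase t := fun j hj =>
      mem_erase.mpr ⟨fun e => htinf (e ▸ hj), E.influential_subset _ hj⟩
    have h1 := card_le_card hsub
    rw [card_erase_of_mem htinf'] at h1
    have h2 := card_pos.mpr ⟨t, htinf'⟩
    omega
  have hc : ((E.C'.influential (C.rerouteSource hF b hC p hxp)).card : ℝ) + 1 ≤
      ((C.reroute p b).influential (C.rerouteSource hF b hC p hxp)).card := by exact_mod_cast hcard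
  have hμE : E.C'.measure αφ αI αQ E.P' (C.rerouteSource hF b hC p hxp) ≤
      (C.reroute p b).measure αφ αI αQ P' (C.rerouteSource hF b hC p hxp) - 1 - αI + αφ := by
    have hm : (E.C'.m : ℝ) + 1 = (C.reroute p b).m := by exact_mod_cast E.m_add_one
    have hpot := E.potential_le
    unfold measure
    nlinarith [mul_le_mul_of_nonneg_left hpot hφ]
  refine ⟨E.C', C.rerouteSource hF b hC p hxp, E.P', E.fair, E.computes, E.packing, hdim, ?_⟩
  linarith

/-! ### Dependence of a ⊕-type gate on a variable it reads -/

/-- A ⊕-type gate `Q = y ⊕ g ⊕ c` of the xor-part depends on the variable `y` when its gate wire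
`g` does not. [cite: LiYang2022, Prop. 2.7] -/
theorem dependsOn_var_of_not_dependsOn_gate (hF : C.Fair) {Q g : Fin C.m} (hQK : Q ∈ C.xorPart) {a : Fin 2}
    {y : Fin n} (hQy : C.arg Q a = .var y) (hQg : C.arg Q a.rev = .gate g) (hg : ¬ C.DependsOn hF g y) :
    C.DependsOn hF Q y := by
  have hgK : g ∈ C.xorPart := C.mem_of_arg_eq Q hQK a.rev g hQg
  have hall : ∀ z : Fin n → Bool, C.sol hF (Function.update z y (!z y)) g = C.sol hF z g := by
    intro z
    by_contra hne
    exact hg (C.dependsOn_of_exists hF hgK ⟨z, hne⟩)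
  obtain ⟨c, hc⟩ := C.sol_eq_xor_of_isXorOp hF (C.isXorOp_of_mem Q hQK)
  intro z h
  rw [hc, hc] at h
  have key : ∀ w, C.nodeVal w (C.sol hF w) (C.arg Q a.rev) = C.sol hF w g := by intro w; rw [hQg]; rfl
  have keyv : ∀ w, C.nodeVal w (C.sol hF w) (C.arg Q a) = w y := by intro w; rw [hQy]; rfl
  rcases fin2_eq_or_eq_rev 0 a with rfl | h1
  · rw [show (1 : Fin 2) = (0 : Fin 2).rev from rfl, key, key, keyv, keyv, hall, Function.update_self] at h
    revert h
    generalize z y = α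
    generalize C.sol hF z g = β
    cases α <;> cases β <;> cases c <;> decide
  · have ha : a = 1 := h1
    subst ha
    rw [show (0 : Fin 2) = (1 : Fin 2).rev from rfl, key, key, keyv, keyv, hall, Function.update_self] at h
    revert h
    generalize z y = α
    generalize C.sol hF z g = β
    cases α <;> cases β <;> cases c <;> decide

/-- **No path, no dependence** (Prop. 2.7): if `x_y` is read only by `Q` and no gate of the
xor-part reads `Q`, a gate `g ≠ Q` of the xor-part does not depend on `x_y` (Li–Yang,
Case 8.2.4.3: "there is no path from `x_k` to `R`, hence `R` does not depend on `x_k`").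
[cite: LiYang2022, Prop. 2.7, §4.1 (Case 8.2.4.3)] -/
theorem not_dependsOn_of_noPath (hF : C.Fair) {y : Fin n} {Q g : Fin C.m}
    (hy : ∀ k a, C.arg k a = .var y → k = Q) (hQ : ∀ k a, C.arg k a = .gate Q → k ∉ C.xorPart)
    (hg : g ∈ C.xorPart) (hgQ : g ≠ Q) : ¬ C.DependsOn hF g y := by
  intro h
  obtain ⟨p⟩ := C.exists_xorPath hF hg h
  have h0 : p.gate 0 = Q := hy _ _ p.arg_zero
  by_cases hlen : p.len = 0
  · have : p.gate 0 = g := by rw [p.eq_last_of_len_eq_zero hlen 0, p.gate_last]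
    exact hgQ (this.symm.trans h0)
  · have hpos : 0 < p.len := Nat.pos_of_ne_zero hlen
    have h1 := p.arg_succ ⟨0, hpos⟩
    have hc : (⟨0, hpos⟩ : Fin p.len).castSucc = 0 := Fin.ext rfl
    rw [hc, h0] at h1
    exact hQ _ _ h1 (p.mem_xorPart _)

/-- The couple of the couple is the variable itself. [folklore] -/
theorem _root_.Literature.Computability.Complexity.QuadEq.other_other_of_reads {R : RdqSource n} {l : Fin n} {e : QuadEq n}
    (he : R.quad l = some e) {j : Fin n} (hr : e.Reads j) : e.other (e.other j) = j :=
  e.other_eq_of_reads (e.reads_other j) hr (e.other_ne hr (R.quad_wf l e he).2.2)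

namespace ProtSubstSit

variable (S : C.ProtSubstSit f R αφ αI αQ)

section Standing

variable (hS : C.Standing R)
include hS

/-- **An ∧-type gate of `K` reading two variables, one of out-degree `≥ 3`, mapped back to `C`**
(Case 8.2.4.1, items 3(c)–(d), and Cases 8.2.4.1.1–8.2.4.1.3): in `C` the gate reads one of
them through `P_k` (no ∧-type gate reads two variables); if the `3⁺`-variable `z` is read
directly, Case 3 excludes it; otherwise `P_k = x_k ⊕ z` with `z` a `1`-variable
(Cases 6.2.2.1–6.2.2.3) or unprotected, when Case 8.1 applies at the gate (`P_k` absorbed, other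
wire a variable). [cite: LiYang2022, §4.1 (Cases 8.2.4.1, 8.2.4.1.1–8.2.4.1.3, 8.1.2, 3)] -/
theorem stepGoal_of_confL5 (hf : IsAffineDisperser f d) (hd : 2 * d + 2 < R.dim) (hF : C.Fair)
    (hC : C.ComputesRestr f R) (h2 : C.NoAndTwoVars) (hφ : 0 ≤ αφ) (hφ2 : αφ ≤ 1 / 2) (hI : 0 ≤ αI) (hQ : 0 ≤ αQ)
    {T : Fin S.K.m} {aT : Fin 2} {z t : Fin n} (hTand : IsAndOp (S.K.op T))
    (hTz : S.K.arg T aT = .var z) (hTt : S.K.arg T aT.rev = .var t) (h3 : 3 ≤ S.K.fanout (.var z)) :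
    C.StepGoal f R αφ αI αQ := by
  have hPN := hS.normalized.1
  have hTandC : IsAndOp (C.op (S.E.ι T)) := (S.E.isAndOp_iff T).mp hTand
  have hzk : z ≠ S.xk := fun e => S.arg_ne_var_xk hS T aT (e ▸ hTz)
  have hzt : z ≠ t := ne_of_arg_var S.normalized.1 hTz hTt
  rcases S.arg_var_cases hS hTz with hzC | ⟨hTP, hrz⟩
  · rcases S.arg_var_cases hS hTt with htC | ⟨-, hrt⟩
    · exact (h2 _ _ _ _ hTandC hzC htC).elim
    · -- `z` directly, a `3⁺`-variable of `C` read by an ∧-type gate: Case 3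
      exfalso
      have hrz : C.arg S.Pk S.ak.rev ≠ .var z := by
        rw [hrt]; exact fun h => hzt (Node.var.inj h).symm
      have hfz : 3 ≤ C.fanout (.var z) := by rw [← S.fanout_var_eq hzk hrz]; exact h3
      have hle := hS.and_fanout_le z (S.E.ι T) aT hzC hTandC
      have h0 : C.fanout (.gate (S.E.ι T)) = 0 := by omega
      exact false_of_and_out_reads_var hf (by omega) hF hC (hPN.out_of_fanout_eq_zero _ h0) hTandC hzC
  · rcases S.arg_var_cases hS hTt with htC | ⟨hTP', -⟩
    · -- `T` reads `P_k = x_k ⊕ z` and `t`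
      by_cases hz1 : C.fanout (.var z) = 1
      · exact case6_2_2_oneVar hf hd hF hC hS hφ hφ2 hI hQ S.hPk hrz S.protected_xk hz1
      · have hzp : ¬ R.Protected z := fun h => hz1 (hS.fanout_eq_one_of_protected h hrz)
        exact stepGoal_case8_1_varXor hf hd hF hC hS hφ (by linarith) hI αQ S.hPk hrz hzk.symm
          (hS.isXorOp_of_protected S.protected_xk S.hPk) hTandC hTP hzp (Or.inr (Or.inl ⟨t, htC⟩))
    · -- both wires into `P_k`: coinciding wires
      exfalso
      have key : C.arg (S.E.ι T) aT ≠ C.arg (S.E.ι T) aT.rev := by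
        have hne := hPN.arg_zero_ne_arg_one (S.E.ι T)
        rcases fin2_eq_or_eq_rev 0 aT with rfl | rfl
        · exact hne
        · exact fun h => hne h.symm
      exact key (hTP.trans hTP'.symm)

/-- **Case 8.2.4.1 of Li–Yang's proof of Theorem 4.1** ("Assume that `Q` (or `P`) computes an
affine function depending on some variable `x_j` with a couple `x_k` that does not feed `P` (or
`Q`)"): `G` reads at `aQ` the gate `Q` of the xor-part (all of whose variables are protected) and
at the other wire the `1`-gate `Q'` of the xor-part; `x_j ∈ supp(Q)` has its couple `x_k` not
read by `Q'`. After `x_k := d` (Case 6; `P_k = x_k ⊕ x_j` is Case 8.2.1), in `K` the gate `G`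
reads `I ∈ {Q, Q″}` depending on `x_j` and the `1`-gate `Q'`; if `I` is a `2⁺`-gate this is
Case 8.2.2 (`case8_2_2_induct`), otherwise `case8_2_4_K` applies and its configurations are
dispatched (`stepGoal_of_conf8252a`, Case 8.1 or `case8_2_2_induct` at the gate reading the path
gate before `I`, `stepGoal_of_confL5`). [cite: LiYang2022, §4.1 (Cases 8.2.4.1, 8.2.2, 8.2.5)] -/
theorem case8_2_4_good (hf : IsAffineDisperser f d) (hd : 2 * d + 2 < R.dim) (hF : C.Fair)
    (hC : C.ComputesRestr f R) (h2 : C.NoAndTwoVars) (hφ : 0 ≤ αφ) (hφ2 : αφ ≤ 1 / 2) (hI : 0 ≤ αI) (hQ : 0 ≤ αQ)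
    {G Q Q' : Fin C.m} {aQ : Fin 2} (hand : IsAndOp (C.op G)) (hGQ : C.arg G aQ = .gate Q)
    (hGQ' : C.arg G aQ.rev = .gate Q') (hQK : Q ∈ C.xorPart) (hQ'K : Q' ∈ C.xorPart)
    (hQ'1 : C.fanout (.gate Q') = 1) (hprot : ∀ s, C.DependsOn hF Q s → R.Protected s)
    {l : Fin n} {e : QuadEq n} (he : R.quad l = some e) (hjr : e.Reads S.xj) (hSj : C.DependsOn hF Q S.xj)
    (hgood : ∀ a, C.arg Q' a ≠ .var (e.other S.xj)) : C.StepGoal f R αφ αI αQ := by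
  classical
  have hPN := hS.normalized.1
  -- the couple of `x_j` is `x_k`, so `Q' ≠ P_k`
  have hee : e = S.e := (RdqSource.quad_unique_of_reads he S.he hjr S.hjr).2
  have hQ'P : Q' ≠ S.Pk := by
    intro h
    apply hgood S.ak
    rw [h, S.hPk, hee, S.other_eq]
  -- `x_j` is read once in `K` (if `P_k` read `x_j`, Case 8.2.1)
  by_cases hr : C.arg S.Pk S.ak.rev = .var S.xj
  · exact case8_2_1 hf hd hF hC hS hφ hφ2 hI hQ S.hPk hr S.he S.hkr
      (S.e.other_eq_of_reads S.hkr S.hjr S.xj_ne_xk.symm)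
  have hxj1 : S.K.fanout (.var S.xj) = 1 := by
    obtain ⟨P, a, hPx, -⟩ := hS.exists_reader_of_protected S.protected_xj
    rw [S.fanout_var_eq S.xj_ne_xk hr]
    exact hS.fanout_eq_one_of_protected S.protected_xj hPx
  -- the configuration in `K`
  rcases S.exists_conf hf hd hF hC hS hφ hφ2 hI hQ hand hGQ hQK hprot hSj with h | ⟨kG, I, hkG, hkand, hkI, hIK, hdepI, -, hIQ⟩
  · exact h
  have HYP : ∀ s, S.K.DependsOn S.fair I s → R.Protected s := by
    intro s hs
    have hsk : s ≠ S.xk := fun e => S.not_dependsOn_xk hF I (e ▸ hs)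
    have hsC := S.dependsOn_C hF hIK hs
    rcases hIQ with hIQ | ⟨hQPk, hQI⟩
    · rw [hIQ] at hsC; exact hprot s hsC
    · subst hQPk
      exact hprot s (dependsOn_of_reads_gate hF hQK S.hPk hQI hsk hsC)
  -- the other wire of `G` in `K`: the `1`-gate `Q'`
  obtain ⟨P₀, hP₀⟩ := S.E.ι_surj Q' hQ'P
  have hkP : S.K.arg kG aQ.rev = .gate P₀ := S.arg_eq_gate hS (by rw [hkG, hP₀]; exact hGQ')
  have hP₀K : P₀ ∈ S.K.xorPart := (S.mem_xorPart_iff P₀).mpr (by rw [hP₀]; exact hQ'K)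
  have hrQ' : C.arg S.Pk S.ak.rev ≠ .gate Q' := by
    intro h
    have hne : S.Pk ≠ G := fun e' =>
      not_isAndOp_of_isXorOp (hS.isXorOp_of_protected S.protected_xk S.hPk) (e' ▸ hand)
    have := two_le_fanout_of_ne hne h hGQ'
    omega
  have hP₀1 : S.K.fanout (.gate P₀) = 1 := by
    have h := S.fanout_gate_add (k' := P₀) (by rw [hP₀]; exact hrQ')
    rw [hP₀, hQ'1] at h
    have := fanout_pos_of_arg_eq hkP
    omega
  have hw : ∀ k, S.K.arg kG aQ.rev = .gate k → ¬ IsAndOp (S.K.op k) := by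
    intro k hk
    rw [hkP] at hk
    cases hk
    exact not_isAndOp_of_isXorOp (S.K.isXorOp_of_mem P₀ hP₀K)
  obtain ⟨p⟩ := S.K.exists_xorPath S.fair hIK hdepI
  -- a `2⁺`-gate `I`: Case 8.2.2
  by_cases hI2 : 2 ≤ S.K.fanout (.gate I)
  · exact S.case8_2_2_induct hS hf hd hF hC hφ hφ2 hI hQ hxj1 p.len p rfl hkand hkI hw hdepI hI2 HYP
  have hI1 : S.K.fanout (.gate I) = 1 := by
    have := fanout_pos_of_arg_eq hkI; omega
  have hd₁ : 2 * d + 2 ≤ S.R₁.dim := by have := S.dim_add_one; omega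
  rcases case8_2_4_K hf hd₁ S.fair S.computes S.normalized S.noTroubled hφ hI αQ hkand hkI hkP hP₀K hP₀1 p hdepI
      S.not_protected_xj hxj1 hI1 with hraw | hO2 | hO3 | hL5
  · obtain ⟨C', R', P', hF', hC', hP', hdim, hμ⟩ := hraw
    have hdim₁ := S.dim_add_one
    refine Or.inr ⟨2, by norm_num, by norm_num, C', R', P', hF', hC', hP', by omega, ?_⟩
    have h1 := S.measure_le
    have hδ := two_liYangDelta_le_five αφ αI αQ
    push_cast
    linarith
  · obtain ⟨hlen0, xl, hother, hlj, hfl⟩ := hO2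
    have h0 : (0 : Fin (p.len + 1)) = Fin.last p.len := p.eq_last_of_len_eq_zero hlen0 0
    have hIj : S.K.arg I (p.pos (Fin.last p.len)) = .var S.xj := by
      have h := p.arg_zero
      rw [h0, p.gate_last] at h
      exact h
    have hIl : S.K.arg I (p.pos (Fin.last p.len)).rev = .var xl := by
      have h := hother
      unfold XorPath.other at h
      rw [p.gate_last] at h
      exact h
    exact S.stepGoal_of_conf8252a hS hf hd hφ hI p.last_mem_xorPart hIj hIl hlj hfl HYP
  · obtain ⟨hpos, T, aT, t, xl, -, hTand, hTB, hTt, hother, hlj⟩ := hO3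
    have hBK : p.gate (p.prev (Fin.last p.len)) ∈ S.K.xorPart := p.mem_xorPart _
    have hIB : S.K.arg I (p.pos (Fin.last p.len)) = .gate (p.gate (p.prev (Fin.last p.len))) :=
      p.arg_last_pos hpos
    have hIl : S.K.arg I (p.pos (Fin.last p.len)).rev = .var xl := by
      have h := hother
      unfold XorPath.other at h
      rw [p.gate_last] at h
      exact h
    have hdepB : S.K.DependsOn S.fair (p.gate (p.prev (Fin.last p.len))) S.xj :=
      dependsOn_gate_of_reads S.fair p.last_mem_xorPart (a := (p.pos (Fin.last p.len)).rev) hIl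
        (by rw [Fin.rev_rev]; exact hIB) hlj.symm hdepI
    have hTandC : IsAndOp (C.op (S.E.ι T)) := (S.E.isAndOp_iff T).mp hTand
    have hBC : S.E.ι (p.gate (p.prev (Fin.last p.len))) ∈ C.xorPart := (S.mem_xorPart_iff _).mp hBK
    have hI'T : I ≠ T := fun e => (S.K.not_mem_xorPart_of_isAndOp hTand) (e ▸ p.last_mem_xorPart)
    have hfBK : 2 ≤ S.K.fanout (.gate (p.gate (p.prev (Fin.last p.len)))) := two_le_fanout_of_ne hI'T hIB hTB
    by_cases hunp : ∃ s, ¬ R.Protected s ∧ C.DependsOn hF (S.E.ι (p.gate (p.prev (Fin.last p.len)))) s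
    · obtain ⟨s, hsp, hdeps⟩ := hunp
      rcases S.arg_gate_cases hS hTB with hTBC | ⟨hTPk, hrB⟩
      · rcases S.arg_var_cases hS hTt with hTtC | ⟨-, hrt⟩
        · exact stepGoal_of_stepBranch2 (case8_1 hf hd hF hC C.isPacking_empty hφ (by linarith) hI αQ hS hTandC
            hTBC hBC hdeps hsp (Or.inr (Or.inl ⟨t, hTtC⟩)))
        · have hne : C.arg S.Pk S.ak.rev ≠ .gate (S.E.ι (p.gate (p.prev (Fin.last p.len)))) := by
            rw [hrt]; exact fun h => by cases h
          have h := S.fanout_gate_add hne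
          have hfB : 2 ≤ C.fanout (.gate (S.E.ι (p.gate (p.prev (Fin.last p.len))))) := by omega
          exact stepGoal_of_stepBranch2 (case8_1 hf hd hF hC C.isPacking_empty hφ (by linarith) hI αQ hS hTandC
            hTBC hBC hdeps hsp (Or.inl hfB))
      · have hTtC : C.arg (S.E.ι T) aT.rev = .var t := by
          rcases S.arg_var_cases hS hTt with h | ⟨-, h⟩
          · exact h
          · rw [hrB] at h; cases h
        have hsk : s ≠ S.xk := fun e => hsp (e ▸ S.protected_xk)
        exact stepGoal_case8_1_varGate hf hd hF hC hS hφ (by linarith) hI αQ S.hPk hrB hBC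
          (hS.isXorOp_of_protected S.protected_xk S.hPk) hdeps hsk hsp hTandC hTPk (Or.inr (Or.inl ⟨t, hTtC⟩))
    · push Not at hunp
      have HYPB : ∀ s, S.K.DependsOn S.fair (p.gate (p.prev (Fin.last p.len))) s → R.Protected s := by
        intro s hs
        by_contra hsp
        exact hunp s hsp (S.dependsOn_C hF hBK hs)
      have hwT : ∀ k, S.K.arg T aT.rev = .gate k → ¬ IsAndOp (S.K.op k) := by
        intro k hk; rw [hTt] at hk; cases hk
      exact S.case8_2_2_induct hS hf hd hF hC hφ hφ2 hI hQ hxj1 (p.len - 1) (p.dropLast hpos) (p.dropLast_len hpos)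
        hTand hTB hwT hdepB hfBK HYPB
  · obtain ⟨T, aT, z, t, -, hTand, hTz, hTt, h3⟩ := hL5
    exact S.stepGoal_of_confL5 hS hf hd hF hC h2 hφ hφ2 hI hQ hTand hTz hTt h3

end Standing

end ProtSubstSit

/-! ### Case 8.2.3 and the dispatch of Case 8.2.4 -/

section Dispatch

/-- **Case 8.2.3 of Li–Yang's proof of Theorem 4.1** ("If `P = t` is a variable, then it is an
unprotected `1`-variable by Case 1, Case 3 and Case 7 … We first substitute constant to `x_k`
to make `x_j` unprotected. After we normalize the circuit, `G` is fed by `t` and a gate `Q′` …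
which computes an affine function depending on `x_j`. Hence by substituting appropriate constant
to `Q′` via xor-reconstruction, we can trivialize `G`, hence make three variables `t`, `x_j`
and `x_k` non-influential, which gives `Δμ ≥ 3α_I/2 ≥ δ`"): with `Q` a `2⁺`-gate this is
Case 8.2.2; otherwise `t` is a `1`-variable (`fanout(t) = 2` is Case 7) and, after `x_k := d`
(`Δμ ≥ 1 + α_I + α_Q`; `P_k = x_k ⊕ t` is Cases 6.2.2.1–6.2.2.3), Case 8.1.2 inside `K` gives
`Δμ ≥ 2α_I + 1 - α_φ`; in total `Δμ ≥ 2 - α_φ + 3α_I + α_Q ≥ 3α_I ≥ 2δ`.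
[cite: LiYang2022, §4.1 (Case 8.2.3)] -/
theorem case8_2_3 (hf : IsAffineDisperser f d) (hd : 2 * d + 2 < R.dim) (hF : C.Fair)
    (hC : C.ComputesRestr f R) (hS : C.Standing R) (h2 : C.NoAndTwoVars)
    (hφ : 0 ≤ αφ) (hφ2 : αφ ≤ 1 / 2) (hI : 0 ≤ αI) (hQ : 0 ≤ αQ)
    {G Q : Fin C.m} {aQ : Fin 2} (hH : C.Case82Hyp hF R G Q aQ)
    (hGin : ∀ (a : Fin 2) (k : Fin C.m), C.arg G a = .gate k → k ∈ C.xorPart)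
    (h7 : ¬ C.Case7Config G) {t : Fin n} (hGt : C.arg G aQ.rev = .var t) : C.StepGoal f R αφ αI αQ := by
  classical
  have hPN := hS.normalized.1
  obtain ⟨hand, hGQ, hQK, hprot, -⟩ := hH
  by_cases hQ2 : 2 ≤ C.fanout (.gate Q)
  · exact ProtSubstSit.case8_2_2 hf hd hF hC hS h2 hφ hφ2 hI hQ ⟨hand, hGQ, hQK, hprot, Or.inl ⟨t, hGt⟩⟩ hGin hQ2
  have hQ1 : C.fanout (.gate Q) = 1 := by have := fanout_pos_of_arg_eq hGQ; omega
  -- `t` is an unprotected `1`-variable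
  have htp : ¬ R.Protected t := fun h => hS.protected_not_and t h G aQ.rev hGt hand
  have hGout : C.out ≠ .gate G := fun h => false_of_and_out_reads_var hf (by omega) hF hC h hand hGt
  have hG1 : 1 ≤ C.fanout (.gate G) := by
    by_contra h0
    push Not at h0
    exact hGout (hPN.out_of_fanout_eq_zero G (by omega))
  have ht3 := hS.and_fanout_le t G aQ.rev hGt hand
  have ht1 : C.fanout (.var t) = 1 := by
    have ht0 : 1 ≤ C.fanout (.var t) := fanout_pos_of_arg_eq hGt
    by_contra hne
    have ht2 : C.fanout (.var t) = 2 := by omega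
    exact h7 ⟨aQ.rev, t, Q, hGt, by rw [Fin.rev_rev]; exact hGQ, ht2, hQ1⟩
  -- `x_j ∈ supp(Q)` and the protected substitution
  obtain ⟨xj, hdepj⟩ := exists_dependsOn_of_nonDegenerate hF hS.nonDegenerate hQK
  have hxj : R.Protected xj := hprot xj hdepj
  rcases stepGoal_or_protSubstSit hf hd hF hC hS h2 hφ hφ2 hI hQ hxj (0 : ZMod 2) with h | ⟨S, hSj, -⟩
  · exact h
  subst hSj
  by_cases hr : C.arg S.Pk S.ak.rev = .var S.xj
  · exact case8_2_1 hf hd hF hC hS hφ hφ2 hI hQ S.hPk hr S.he S.hkr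
      (S.e.other_eq_of_reads S.hkr S.hjr S.xj_ne_xk.symm)
  by_cases hrt : C.arg S.Pk S.ak.rev = .var t
  · exact case6_2_2_oneVar hf hd hF hC hS hφ hφ2 hI hQ S.hPk hrt S.protected_xk ht1
  have hxj1 : S.K.fanout (.var S.xj) = 1 := by
    obtain ⟨P, a, hPx, -⟩ := hS.exists_reader_of_protected S.protected_xj
    rw [S.fanout_var_eq S.xj_ne_xk hr]
    exact hS.fanout_eq_one_of_protected S.protected_xj hPx
  rcases S.exists_conf hf hd hF hC hS hφ hφ2 hI hQ hand hGQ hQK hprot hdepj with h | ⟨kG, I, hkG, hkand, hkI, hIK, hdepI, -, -⟩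
  · exact h
  have htk : t ≠ S.xk := fun e => htp (e ▸ S.protected_xk)
  have htj : t ≠ S.xj := fun e => htp (e ▸ S.protected_xj)
  have hkt : S.K.arg kG aQ.rev = .var t := S.arg_eq_var hS (by rw [hkG]; exact hGt)
  have hKt1 : S.K.fanout (.var t) = 1 := by rw [S.fanout_var_eq htk hrt]; exact ht1
  have htp₁ : ¬ S.R₁.Protected t := fun h => htp (S.protected_of_protected h)
  obtain ⟨p⟩ := S.K.exists_xorPath S.fair hIK hdepI
  have hd₁ : 2 * d + 2 ≤ S.R₁.dim := by have := S.dim_add_one; omega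
  obtain ⟨C', R', P', hF', hC', hP', hdim, hμ⟩ := case8_1_2_raw hf hd₁ S.fair S.computes S.K.isPacking_empty hφ hI αQ
    hkand hkI p hdepI S.not_protected_xj hkt hKt1 htp₁ htj
  have hdim₁ := S.dim_add_one
  refine Or.inr ⟨2, by norm_num, by norm_num, C', R', P', hF', hC', hP', by omega, ?_⟩
  have h1 := S.measure_le
  have hδ := liYangDelta_le_four_thirds αφ αI αQ
  push_cast
  nlinarith

/-- **Case 8.2.4.2 / Case 8.2.1 at a gate reading two variables**: `G` reads the gates `P` and
`Q₂` of the xor-part, `Q₂` a `1`-gate, `P` reading two variables on which it depends, hence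
protected: coupled (Case 8.2.1) or not (Case 8.2.4.2). [cite: LiYang2022, §4.1 (Cases 8.2.1, 8.2.4.2)] -/
theorem stepGoal_of_reads_two_vars (hf : IsAffineDisperser f d) (hd : 2 * d + 2 < R.dim) (hF : C.Fair)
    (hC : C.ComputesRestr f R) (hS : C.Standing R)
    (hφ : 0 ≤ αφ) (hφ2 : αφ ≤ 1 / 2) (hI : 0 ≤ αI) (hQ : 0 ≤ αQ)
    {G P Q₂ : Fin C.m} {a b₀ : Fin 2} {y₁ y₂ : Fin n}
    (hand : IsAndOp (C.op G)) (hGP : C.arg G a = .gate P) (hGQ : C.arg G a.rev = .gate Q₂)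
    (hQ₂K : Q₂ ∈ C.xorPart) (hQ₂1 : C.fanout (.gate Q₂) = 1) (hPK : P ∈ C.xorPart)
    (hprotP : ∀ s, C.DependsOn hF P s → R.Protected s)
    (hP0 : C.arg P b₀ = .var y₁) (hP1 : C.arg P b₀.rev = .var y₂) : C.StepGoal f R αφ αI αQ := by
  have hy12 : y₁ ≠ y₂ := ne_of_arg_var hS.normalized.1 hP0 hP1
  have hy₂ : R.Protected y₂ := hprotP y₂ (dependsOn_var_of_reads_vars hF hPK hP0 hP1 hy12)
  have hy₁ : R.Protected y₁ :=
    hprotP y₁ (dependsOn_var_of_reads_vars hF hPK (a := b₀.rev) hP1 (by rw [Fin.rev_rev]; exact hP0) hy12.symm)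
  obtain ⟨-, l₁, e₁, he₁, hr₁⟩ := hy₁
  obtain ⟨-, l₂, e₂, he₂, hr₂⟩ := hy₂
  by_cases hll : l₁ = l₂
  · subst hll
    rw [he₁] at he₂
    cases he₂
    exact case8_2_1 hf hd hF hC hS hφ hφ2 hI hQ hP0 hP1 he₁ hr₁ (e₁.other_eq_of_reads hr₁ hr₂ hy12)
  · exact case8_2_4_2 hf hd hF hC hS hφ hI αQ hand hGP hGQ hQ₂K hQ₂1 hP0 hP1 he₁ hr₁ he₂ hr₂ hll

/-- **Case 8.2.4 of Li–Yang's proof of Theorem 4.1** ("Assume that `P` is an ⊕-type `1`-gate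
… we assume that both `P` and `Q` merely depend on protected variables"), `Q` a `1`-gate too:
if `P` or `Q` reads two variables, Case 8.2.4.2 (or 8.2.1); if some variable of `supp(Q)` has
its couple not read by `P`, or some variable of `supp(P)` has its couple not read by `Q`,
Case 8.2.4.1 (`case8_2_4_good`, in that orientation); otherwise Case 8.2.4.3: `Q` reads the
couple `x_c` of a variable of `supp(P)` and a gate `R'`; no path leads from `x_c` to `R'`
(`x_c` is read by `Q` only, `Q` by `G` only), so `R'` does not depend on `x_c`, `Q` does, and
then every variable of `supp(R')` would lie in `supp(Q)`, whose couples are all the one variable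
read by `P` — `supp(R') = ∅`, contradicting non-degeneracy.
[cite: LiYang2022, §4.1 (Cases 8.2.4, 8.2.4.1, 8.2.4.2, 8.2.4.3)] -/
theorem case8_2_4 (hf : IsAffineDisperser f d) (hd : 2 * d + 2 < R.dim) (hF : C.Fair)
    (hC : C.ComputesRestr f R) (hS : C.Standing R) (h2 : C.NoAndTwoVars)
    (hφ : 0 ≤ αφ) (hφ2 : αφ ≤ 1 / 2) (hI : 0 ≤ αI) (hQ : 0 ≤ αQ)
    {G Q : Fin C.m} {aQ : Fin 2} (hH : C.Case82Hyp hF R G Q aQ)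
    {Q' : Fin C.m} (hGQ' : C.arg G aQ.rev = .gate Q') (hQ1 : C.fanout (.gate Q) = 1) :
    C.StepGoal f R αφ αI αQ := by
  classical
  have hPN := hS.normalized.1
  obtain ⟨hand, hGQ, hQK, hprot, hw⟩ := hH
  obtain ⟨hQ'K, hQ'1, hprot'⟩ : Q' ∈ C.xorPart ∧ C.fanout (.gate Q') = 1 ∧
      ∀ s, C.DependsOn hF Q' s → R.Protected s := by
    rcases hw with ⟨t, ht⟩ | ⟨Q'', hGQ'', hK, hle, hpr⟩
    · rw [hGQ'] at ht; cases ht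
    · rw [hGQ'] at hGQ''
      cases hGQ''
      have h1 : C.fanout (.gate Q') = 1 := by
        have := fanout_pos_of_arg_eq hGQ'; omega
      exact ⟨hK, h1, hpr (by rw [h1, hQ1])⟩
  have hGQ'' : C.arg G aQ.rev.rev = .gate Q := by rw [Fin.rev_rev]; exact hGQ
  -- a gate reading two variables: Cases 8.2.1 / 8.2.4.2
  by_cases hQv : ∃ (b₀ : Fin 2) (y₁ y₂ : Fin n), C.arg Q b₀ = .var y₁ ∧ C.arg Q b₀.rev = .var y₂
  · obtain ⟨b₀, y₁, y₂, h0, h1⟩ := hQv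
    exact stepGoal_of_reads_two_vars hf hd hF hC hS hφ hφ2 hI hQ hand hGQ hGQ' hQ'K hQ'1 hQK hprot h0 h1
  by_cases hQ'v : ∃ (b₀ : Fin 2) (y₁ y₂ : Fin n), C.arg Q' b₀ = .var y₁ ∧ C.arg Q' b₀.rev = .var y₂
  · obtain ⟨b₀, y₁, y₂, h0, h1⟩ := hQ'v
    exact stepGoal_of_reads_two_vars hf hd hF hC hS hφ hφ2 hI hQ hand hGQ' hGQ'' hQK hQ1 hQ'K hprot' h0 h1
  -- a good orientation: Case 8.2.4.1
  by_cases hA : ∃ (x l : Fin n) (e : QuadEq n), C.DependsOn hF Q x ∧ R.quad l = some e ∧ e.Reads x ∧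
      ∀ a, C.arg Q' a ≠ .var (e.other x)
  · obtain ⟨x, l, e, hdepx, he, hr, hgood⟩ := hA
    have hx : R.Protected x := hprot x hdepx
    rcases stepGoal_or_protSubstSit hf hd hF hC hS h2 hφ hφ2 hI hQ hx (0 : ZMod 2) with h | ⟨S, hSj, -⟩
    · exact h
    subst hSj
    exact S.case8_2_4_good hS hf hd hF hC h2 hφ hφ2 hI hQ hand hGQ hGQ' hQK hQ'K hQ'1 hprot he hr hdepx hgood
  by_cases hB : ∃ (x l : Fin n) (e : QuadEq n), C.DependsOn hF Q' x ∧ R.quad l = some e ∧ e.Reads x ∧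
      ∀ a, C.arg Q a ≠ .var (e.other x)
  · obtain ⟨x, l, e, hdepx, he, hr, hgood⟩ := hB
    have hx : R.Protected x := hprot' x hdepx
    rcases stepGoal_or_protSubstSit hf hd hF hC hS h2 hφ hφ2 hI hQ hx (0 : ZMod 2) with h | ⟨S, hSj, -⟩
    · exact h
    subst hSj
    exact S.case8_2_4_good hS hf hd hF hC h2 hφ hφ2 hI hQ hand hGQ' hGQ'' hQ'K hQK hQ1 hprot' he hr hdepx hgood
  -- Case 8.2.4.3: impossible
  exfalso
  push Not at hA hB
  -- a variable of `supp(Q')`; its couple `c` is read by `Q`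
  obtain ⟨x₀', hdep₀'⟩ := exists_dependsOn_of_nonDegenerate hF hS.nonDegenerate hQ'K
  obtain ⟨-, l₀, e₀, he₀, hr₀⟩ := hprot' x₀' hdep₀'
  obtain ⟨a, hQc⟩ := hB x₀' l₀ e₀ hdep₀' he₀ hr₀
  have hcprot : R.Protected (e₀.other x₀') := RdqSource.protected_of_reads he₀ (e₀.reads_other x₀')
  -- the other wire of `Q` is a gate `g`
  obtain ⟨g, hQg⟩ : ∃ g, C.arg Q a.rev = .gate g := by
    cases h : C.arg Q a.rev with
    | const b => exact absurd h (hPN.arg_ne_const Q a.rev b)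
    | var y => exact absurd ⟨a, _, y, hQc, h⟩ hQv
    | gate g => exact ⟨g, rfl⟩
  have hgK : g ∈ C.xorPart := C.mem_of_arg_eq Q hQK a.rev g hQg
  have hgQ : g ≠ Q := fun e => not_reads_self_of_standing hF hPN hS.nonDegenerate Q a.rev (e ▸ hQg)
  -- no path from `c` to `g`: `c` is read by `Q` only, `Q` by `G` only
  have hgc : ¬ C.DependsOn hF g (e₀.other x₀') := by
    refine not_dependsOn_of_noPath hF (Q := Q)
      (fun k a' hk => hS.protected_one_reader _ hcprot k Q a' a hk hQc) (fun k a' hk hkK => ?_) hgK hgQ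
    have := eq_of_arg_eq_of_fanout_eq_one hPN.arg_zero_ne_arg_one hQ1 hk hGQ
    exact (C.not_mem_xorPart_of_isAndOp hand) (this ▸ hkK)
  -- so `Q` depends on `c`, and `Q'` reads the couple of `c`
  have hQdc : C.DependsOn hF Q (e₀.other x₀') := dependsOn_var_of_not_dependsOn_gate hF hQK hQc hQg hgc
  obtain ⟨-, l₁, e₁, he₁, hr₁⟩ := hprot _ hQdc
  obtain ⟨a₁, hQ'c⟩ := hA _ l₁ e₁ hQdc he₁ hr₁
  -- a variable of `supp(g)`, other than `c`, lies in `supp(Q)`; `Q'` reads its couple too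
  obtain ⟨s, hdeps⟩ := exists_dependsOn_of_nonDegenerate hF hS.nonDegenerate hgK
  by_cases hsc : s = e₀.other x₀'
  · exact hgc (hsc ▸ hdeps)
  have hQs : C.DependsOn hF Q s := dependsOn_of_reads_gate hF hQK hQc hQg hsc hdeps
  obtain ⟨-, lₛ, eₛ, heₛ, hrₛ⟩ := hprot s hQs
  obtain ⟨aₛ, hQ'ₛ⟩ := hA s lₛ eₛ hQs heₛ hrₛ
  -- `Q'` reads one variable only: the two couples coincide
  have haa : aₛ = a₁ := by
    rcases fin2_eq_or_eq_rev a₁ aₛ with h | h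
    · exact h
    · rw [h] at hQ'ₛ
      exact absurd ⟨a₁, _, _, hQ'c, hQ'ₛ⟩ hQ'v
  rw [haa, hQ'c] at hQ'ₛ
  have hoo : e₁.other (e₀.other x₀') = eₛ.other s := Node.var.inj hQ'ₛ
  -- the same quadratic equation reads that variable, so `s = c`
  obtain ⟨-, hee⟩ := RdqSource.quad_unique_of_reads he₁ heₛ (e₁.reads_other (e₀.other x₀'))
    (by rw [hoo]; exact eₛ.reads_other s)
  subst hee
  have h1 := QuadEq.other_other_of_reads he₁ hr₁
  have h3 := QuadEq.other_other_of_reads heₛ hrₛ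
  rw [hoo] at h1
  exact hsc (h3.symm.trans h1)

/-- **Case 8.2 of Li–Yang's proof of Theorem 4.1, assembled**: Case 8.2.2 when `Q` is a
`2⁺`-gate (`ProtSubstSit.case8_2_2`), Case 8.2.3 when the other wire of `G` is a variable
(`case8_2_3`), Case 8.2.4 when it is a gate (`case8_2_4`).
[cite: LiYang2022, §4.1 (Case 8.2)] -/
theorem case8_2_assembled (hf : IsAffineDisperser f d) (hd : 2 * d + 2 < R.dim) (hF : C.Fair)
    (hC : C.ComputesRestr f R) (hS : C.Standing R) (h2 : C.NoAndTwoVars)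
    (hφ : 0 ≤ αφ) (hφ2 : αφ ≤ 1 / 2) (hI : 0 ≤ αI) (hQ : 0 ≤ αQ)
    {G Q : Fin C.m} {aQ : Fin 2} (hH : C.Case82Hyp hF R G Q aQ)
    (hGin : ∀ (a : Fin 2) (k : Fin C.m), C.arg G a = .gate k → k ∈ C.xorPart)
    (h7 : ¬ C.Case7Config G) : C.StepGoal f R αφ αI αQ := by
  by_cases hQ2 : 2 ≤ C.fanout (.gate Q)
  · exact ProtSubstSit.case8_2_2 hf hd hF hC hS h2 hφ hφ2 hI hQ hH hGin hQ2
  have hQ1 : C.fanout (.gate Q) = 1 := by have := fanout_pos_of_arg_eq hH.2.1; omega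
  cases hw : C.arg G aQ.rev with
  | const b => exact absurd hw (hS.normalized.1.arg_ne_const G aQ.rev b)
  | var t => exact case8_2_3 hf hd hF hC hS h2 hφ hφ2 hI hQ hH hGin h7 hw
  | gate Q' => exact case8_2_4 hf hd hF hC hS h2 hφ hφ2 hI hQ hH hw hQ1

end Dispatch

end Semicircuit

open Semicircuit

/-- **Case 8.2 of the proof of Thm. 4.1 in the form required by the dispatcher**
`LiYang2022_cases6to8_of_case8_2`. [cite: LiYang2022, §4.1 (Case 8.2)] -/
theorem case8_2 : ∀ (αφ αI αQ : ℝ), 0 < αφ → αφ < 1 / 2 → 0 < αI → 0 < αQ →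
    ∀ (n d : ℕ) (f : (Fin n → ZMod 2) → Bool), IsAffineDisperser f d →
    ∀ (C : Semicircuit n) (R : RdqSource n) (hF : C.Fair), C.ComputesRestr f R → 2 * d + 2 < R.dim →
      C.Standing R → C.NoAndTwoVars → ∀ (G Q : Fin C.m) (aQ : Fin 2), C.Case82Hyp hF R G Q aQ → G ∉ C.xorPart →
      (∀ (a : Fin 2) (k : Fin C.m), C.arg G a = .gate k → k ∈ C.xorPart) → ¬ C.Case7Config G →
      C.StepGoal f R αφ αI αQ := by
  intro αφ αI αQ hφ hφ2 hI hQ n d f hf C R hF hC hd hS h2 G Q aQ hH _ hGin h7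
  exact case8_2_assembled hf hd hF hC hS h2 hφ.le hφ2.le hI.le hQ.le hH hGin h7

/-- **Cases 6 and 8 of the proof of Li–Yang's Theorem 4.1** (the named fact
`LiYang2022_cases6to8`), PROVED. [cite: LiYang2022, §4.1 (Cases 6, 8)] -/
theorem LiYang2022_cases6to8_holds : LiYang2022_cases6to8 :=
  LiYang2022_cases6to8_of_case8_2 case8_2

end Literature.Computability.Complexity
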